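import Literature.ModelTheory.ExponentialFields.PilaWilkieCountingCells
import Literature.ModelTheory.ExponentialFields.PilaWilkieMainLemmaFamily
import Literature.ModelTheory.ExponentialFields.OMinimalCellFibres
import Literature.ModelTheory.ExponentialFields.OMinimalDimensionCorollaries
import Literature.ModelTheory.ExponentialFields.OMinimalFibreBounds
import HarnessLib

/-!
# The counting theorem for definable families and Pila–Wilkie 1.8 from the reparametrization property (Bhardwaj–van den Dries 2022, Thm. 2.4)

Topic `Literature/ModelTheory/ExponentialFields`; proof file in the cone of the named fact
`PilaWilkie2006_thm_1_8`.  Bhardwaj–van den Dries 2022, §2 prove the Pila–Wilkie counting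
theorem for all members of a definable family at once (Thm. 2.4: *"there is a constant
`c = c(X, ε)` such that for all `s ∈ E` and all `T` we have `N(X(s)^{tr}, T) ≤ cT^ε`"*) by
induction on the ambient dimension `n`: remove interiors, cover the rational points of bounded
height by few hypersurfaces (the Main Lemma), decompose the hypersurfaces into semialgebraic
cells (Lemma 2.3) and project the slices on non-open cells injectively to lower dimension
(Lemma 2.2), where the induction hypothesis applies to the definable family of projected
slices.  This file carries that out over an arbitrary o-minimal expansion of the real field,
**modulo the uniform `r`-reparametrization property** `UR(r, ℓ)` (the o-minimal
Yomdin–Gromov theorem for definable families, Pila–Wilkie 2006 §§4–5 / BvdD §§4–7), which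
enters through `mainLemma_family` and is stated inline as a hypothesis:

* `countingFamily` — Thm. 2.4 for families with fibres in the open unit cube, assuming
  `UR(r, ℓ)` for all `r` and `ℓ < n` (interiors are removed as the fibres of the open cells of
  a decomposition of the total space; `dim < n` for the rest by van den Dries Ch. 4 (1.4));
* `PilaWilkie2006_thm_1_8_of_uniformReparam` — **Pila–Wilkie 2006, Thm. 1.8, conditional
  on `UR(r, ℓ)` for every o-minimal expansion of the real field and all `r, ℓ`**, through the
  cube reduction `PilaWilkie2006_thm_1_8_of_unitCube`.  (`UR(r,0)`, `UR(r,1)` are proved in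
  `PilaWilkieUniformReparamLow`; the general case is the subject of the remaining files.)

Helpers: `mem_transPart_inter`, `transPart_iUnion₂_subset` (Lemma 2.1),
`transPart_eq_empty_of_isOpen`, `ncard_biUnion_le_sum`, `IsSemialgebraic.fibre_append` (and the
tree's `definable_fibre_append`).

Nothing here is a named fact; no definitions.

## References

* N. Bhardwaj, L. van den Dries, *On the Pila–Wilkie theorem*, Expo. Math. 40 (2022), §2,
  Thm. 2.4. [BhardwajVanDenDries2022]
* J. Pila, A. J. Wilkie, *The rational points of a definable set*, Duke Math. J. 133 (2006),
  Thm. 1.8, Thm. 1.10, §7. [PilaWilkie2006]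
-/

noncomputable section

open Set FirstOrder FirstOrder.Language Filter Topology

namespace Literature.ModelTheory.ExponentialFields

/-! ### Helpers for the family counting theorem -/

section CountingHelpers

open Classical

variable {L : Language} [L.Structure ℝ]

/-- A point of `X^{tr}` lying on `Y` lies on `(X ∩ Y)^{tr}`. [folklore] -/
theorem mem_transPart_inter {n : ℕ} {X Y : Set (Fin n → ℝ)} {x : Fin n → ℝ}
    (hx : x ∈ transPart X) (hxY : x ∈ Y) : x ∈ transPart (X ∩ Y) :=
  ⟨⟨hx.1, hxY⟩, fun h => hx.2 (algPart_mono inter_subset_left h)⟩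

/-- The transcendental part of a finite union lies in the union of the transcendental parts
(Bhardwaj–van den Dries 2022, Lemma 2.1). [cite: BhardwajVanDenDries2022, Lemma 2.1] -/
theorem transPart_iUnion₂_subset {n : ℕ} {α : Type*} (s : Finset α) (A : α → Set (Fin n → ℝ)) :
    transPart (⋃ a ∈ s, A a) ⊆ ⋃ a ∈ s, transPart (A a) := by
  intro x hx
  obtain ⟨hxU, hxalg⟩ := hx
  simp only [mem_iUnion] at hxU ⊢
  obtain ⟨a, ha, hxa⟩ := hxU
  refine ⟨a, ha, hxa, fun h => hxalg (algPart_mono (fun y hy => ?_) h)⟩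
  exact mem_iUnion₂.mpr ⟨a, ha, hy⟩

/-- A non-empty open subset of `ℝ^n`, `n ≥ 1`, is its own algebraic part: every point lies in an
open box, a connected infinite semialgebraic subset (Bhardwaj–van den Dries 2022, after Lemma
2.1: *"if `X` is open in `ℝ^n`, then `X^{tr} = ∅`"*). [cite: BhardwajVanDenDries2022, §2] -/
theorem transPart_eq_empty_of_isOpen {n : ℕ} (hn : 1 ≤ n) {U : Set (Fin n → ℝ)} (hU : IsOpen U) :
    transPart U = ∅ := by
  ext x
  simp only [mem_empty_iff_false, iff_false]
  rintro ⟨hxU, hxalg⟩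
  apply hxalg
  -- an open box around `x` inside `U`
  obtain ⟨ε, hε, hball⟩ := Metric.isOpen_iff.mp hU x hxU
  rw [mem_algPart_iff]
  refine ⟨Set.pi univ fun i => Ioo (x i - ε / 2) (x i + ε / 2), ?_, ?_, ?_, ?_, ?_⟩
  · intro i _; constructor <;> linarith
  · intro y hy
    apply hball
    rw [Metric.mem_ball, dist_pi_lt_iff hε]
    intro i
    have h := hy i (mem_univ _)
    rw [Real.dist_eq, abs_lt]; constructor <;> linarith [h.1, h.2]
  · exact isSemialgebraic_pi_Ioo _ _
  · exact ⟨Set.univ_pi_nonempty_iff.mpr fun i => ⟨x i, by constructor <;> linarith⟩,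
      isPreconnected_univ_pi fun i => isPreconnected_Ioo⟩
  · -- infinite: contains a segment in the first coordinate direction
    have i₀ : Fin n := ⟨0, hn⟩
    have hseg : (fun t : ℝ => Function.update x i₀ t) '' Ioo (x i₀ - ε / 2) (x i₀ + ε / 2) ⊆
        Set.pi univ fun i => Ioo (x i - ε / 2) (x i + ε / 2) := by
      rintro _ ⟨t, ht, rfl⟩ i _
      show Function.update x i₀ t i ∈ Ioo (x i - ε / 2) (x i + ε / 2)
      by_cases hi : i = i₀
      · subst hi; simp only [Function.update_self]; exact ht
      · rw [Function.update_of_ne hi]; constructor <;> linarith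
    refine Set.Infinite.mono hseg ((Set.Ioo_infinite (by linarith)).image ?_)
    intro t _ t' _ h
    have := congrArg (fun z => z i₀) h
    simpa using this

/-- Counting over finite unions. [folklore] -/
theorem ncard_biUnion_le_sum {α β : Type*} (s : Finset α) (f : α → Set β) (hf : ∀ a ∈ s, (f a).Finite) :
    (⋃ a ∈ s, f a).Finite ∧ (⋃ a ∈ s, f a).ncard ≤ ∑ a ∈ s, (f a).ncard := by
  induction s using Finset.induction_on with
  | empty => simp
  | insert a s ha ih =>
    obtain ⟨hfin, hle⟩ := ih fun b hb => hf b (Finset.mem_insert_of_mem hb)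
    have hfa := hf a (Finset.mem_insert_self a s)
    rw [Finset.set_biUnion_insert, Finset.sum_insert ha]
    exact ⟨hfa.union hfin, (Set.ncard_union_le _ _).trans (by omega)⟩

/-- Fibres of semialgebraic sets over real points are semialgebraic (substitute the parameters).
[folklore] -/
theorem IsSemialgebraic.fibre_append {D n : ℕ} {C : Set (Fin (D + n) → ℝ)} (hC : IsSemialgebraic ℝ C)
    (t : Fin D → ℝ) : IsSemialgebraic ℝ {x : Fin n → ℝ | (Fin.append t x :) ∈ C} := by
  have h := hC.preimage_aeval (ι := Fin n)
    (Fin.append (fun i => MvPolynomial.C (t i)) (fun j => MvPolynomial.X j) : Fin (D + n) → MvPolynomial (Fin n) ℝ)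
  convert h using 1
  ext x
  simp only [mem_setOf_eq, mem_preimage]
  have : (fun k => MvPolynomial.aeval x ((Fin.append (fun i => MvPolynomial.C (t i)) (fun j => MvPolynomial.X j) : Fin (D + n) → MvPolynomial (Fin n) ℝ) k)) = Fin.append t x := by
    funext k
    refine Fin.addCases (fun i => ?_) (fun j => ?_) k
    · simp
    · simp
  rw [this]

end CountingHelpers

/-! ### The counting theorem for definable families (Bhardwaj–van den Dries 2022, Thm. 2.4), modulo `UR` -/

section CountingFamilies

open Classical

variable {L : Language} [L.Structure ℝ]

/-- Local notation: the open unit cube `(0,1)^ℓ`. -/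
local notation "𝕀^" ℓ:max => (Set.pi Set.univ fun _ : Fin ℓ => Set.Ioo (0 : ℝ) 1)

/-- **The counting theorem for definable families** (Bhardwaj–van den Dries 2022, Thm. 2.4:
*"Let any `ε` be given. Then there is a constant `c = c(X,ε)` such that for all `s ∈ E` and all
`T` we have `N(X(s)^{tr}, T) ≤ cT^ε`"*; Pila–Wilkie 2006, Thm. 1.10/§7), for families with
fibres in the open unit cube, **modulo the uniform `r`-reparametrization property** `UR(r, ℓ)`
for all `r` and all `ℓ < n` (inline hypothesis).  By strong induction on `n` following BvdD §2:
remove the open cells (their fibres are open, hence purely algebraic), slice the rest with the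
`≤ K T^{ε/2}` hypersurfaces of the Main Lemma (`mainLemma_family`), decompose those into the
semialgebraic cells of Lemma 2.3 (`exists_hypersurface_cells`), and project each non-open cell
injectively to lower dimension (`IsCell.exists_coordProj`, Lemma 2.2
`ncard_ratPointsLE_transPart_le_coordProj`), where the induction hypothesis applies to the
definable family of projected slices. [cite: BhardwajVanDenDries2022, Thm. 2.4]
[cite: PilaWilkie2006, Thm. 1.10] -/
theorem countingFamily (hO : L.IsOMinimal ℝ)
    (hadd : (univ : Set ℝ).Definable L {v : Fin 3 → ℝ | v 0 + v 1 = v 2})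
    (hmul : (univ : Set ℝ).Definable L {v : Fin 3 → ℝ | v 0 * v 1 = v 2}) :
    ∀ (n : ℕ),
    (∀ (r ℓ : ℕ), ℓ < n → ∀ (n' m : ℕ) (F : Fin n' → (Fin m → ℝ) → (Fin ℓ → ℝ) → ℝ),
      (∀ l, IsDefinableFamily L (F l)) → (∀ l v, ∀ x ∈ 𝕀^ℓ, |F l v x| ≤ 1) →
      ∃ (κ : Type) (_ : Fintype κ) (ψ : κ → (Fin m → ℝ) → (Fin ℓ → ℝ) → (Fin ℓ → ℝ)),
        (∀ j c, IsDefinableFamily L (fun v x => ψ j v x c)) ∧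
        ∀ v, (∀ j, MapsTo (ψ j v) (𝕀^ℓ) (𝕀^ℓ)) ∧ (⋃ j, ψ j v '' 𝕀^ℓ) = 𝕀^ℓ ∧
          (∀ j c, ContDiffOn ℝ r (fun x => ψ j v x c) (𝕀^ℓ)) ∧
          (∀ j c, ∀ q ≤ r, ∀ x ∈ 𝕀^ℓ, ‖iteratedFDeriv ℝ q (fun x => ψ j v x c) x‖ ≤ 1) ∧
          (∀ j l, ContDiffOn ℝ r (fun x => F l v (ψ j v x)) (𝕀^ℓ)) ∧
          (∀ j l, ∀ q ≤ r, ∀ x ∈ 𝕀^ℓ, ‖iteratedFDeriv ℝ q (fun x => F l v (ψ j v x)) x‖ ≤ 1)) →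
    ∀ (p : ℕ) (Z : Set (Fin (p + n) → ℝ)), (univ : Set ℝ).Definable L Z →
      (∀ v : Fin p → ℝ, {z : Fin n → ℝ | (Fin.append v z :) ∈ Z} ⊆ 𝕀^n) →
      ∀ ε : ℝ, 0 < ε → ∃ c : ℝ, 0 ≤ c ∧ ∀ (v : Fin p → ℝ) (H : ℕ), 1 ≤ H →
        (ratPointsLE (transPart {z : Fin n → ℝ | (Fin.append v z :) ∈ Z}) H).Finite ∧
        ((ratPointsLE (transPart {z : Fin n → ℝ | (Fin.append v z :) ∈ Z}) H).ncard : ℝ) ≤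
          c * (H : ℝ) ^ ε := by
  have hlt := definable_lt_of_field hadd hmul
  intro n
  induction n using Nat.strong_induction_on with
  | _ n ih =>
  intro hUR p Z hZ hZsub ε hε
  rcases Nat.eq_zero_or_pos n with rfl | hn
  · -- `n = 0`: the fibres are subsets of the one-point space
    refine ⟨1, zero_le_one, fun v H hH => ?_⟩
    have hsub : (ratPointsLE (transPart {z : Fin 0 → ℝ | (Fin.append v z :) ∈ Z}) H).Subsingleton :=
      fun a _ b _ => funext fun i => i.elim0
    refine ⟨hsub.finite, ?_⟩
    rw [one_mul]
    have h1 : (ratPointsLE (transPart {z : Fin 0 → ℝ | (Fin.append v z :) ∈ Z}) H).ncard ≤ 1 :=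
      (Set.ncard_le_one_iff hsub.finite).mpr fun ha hb => hsub ha hb
    calc ((ratPointsLE (transPart {z : Fin 0 → ℝ | (Fin.append v z :) ∈ Z}) H).ncard : ℝ) ≤ 1 := by
          exact_mod_cast h1
      _ ≤ (H : ℝ) ^ ε := Real.one_le_rpow (by exact_mod_cast hH) hε.le
  -- `n ≥ 1`
  ------------------------------------------------------------------ A: remove the open cells
  obtain ⟨𝒟, h𝒟, hpart⟩ := CellDecomposition.cellDecomposition_I hO hlt {Z} (by simpa using hZ)
  have hcellex : ∀ C ∈ 𝒟, ∃ ι, IsCell L (p + n) ι C := h𝒟.isCell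
  choose! ι hι using hcellex
  set τ : Set (Fin (p + n) → ℝ) → (Fin n → Bool) := fun C j => ι C (Fin.natAdd p j) with hτ
  set 𝒟Z : Finset (Set (Fin (p + n) → ℝ)) := 𝒟.filter fun C => C ⊆ Z with h𝒟Z
  set 𝒟thin : Finset (Set (Fin (p + n) → ℝ)) := 𝒟Z.filter fun C => τ C ≠ fun _ => true with h𝒟thin
  set 𝒟full : Finset (Set (Fin (p + n) → ℝ)) := 𝒟Z.filter fun C => τ C = fun _ => true with h𝒟full
  set X : Set (Fin (p + n) → ℝ) := ⋃ C ∈ 𝒟thin, C with hXdef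
  set O : Set (Fin (p + n) → ℝ) := ⋃ C ∈ 𝒟full, C with hOdef
  have hmem𝒟 : ∀ {C}, C ∈ 𝒟thin ∨ C ∈ 𝒟full → C ∈ 𝒟 ∧ C ⊆ Z := by
    intro C hC
    rcases hC with hC | hC
    · exact Finset.mem_filter.mp (Finset.mem_filter.mp hC).1
    · exact Finset.mem_filter.mp (Finset.mem_filter.mp hC).1
  have hXdefn : (univ : Set ℝ).Definable L X := by
    have heq : X = ⋃ C : (𝒟thin : Set (Set (Fin (p + n) → ℝ))), (C : Set (Fin (p + n) → ℝ)) := by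
      ext w; simp [hXdef]
    rw [heq]
    exact definable_iUnion_of_finite fun C => (hι C (hmem𝒟 (Or.inl (Finset.mem_coe.mp C.2))).1).definable hlt
  have hXZ : X ⊆ Z := iUnion₂_subset fun C hC => (hmem𝒟 (Or.inl hC)).2
  have hZXO : Z ⊆ X ∪ O := by
    intro w hw
    obtain ⟨C, hC, hwC⟩ := h𝒟.exists_mem w
    have hCZ : C ⊆ Z := by
      rcases hpart Z (Finset.mem_singleton_self Z) C hC with h | h
      · exact h
      · exact absurd hw (disjoint_left.mp h hwC)
    have hCZ' : C ∈ 𝒟Z := Finset.mem_filter.mpr ⟨hC, hCZ⟩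
    by_cases hfull : τ C = fun _ => true
    · exact Or.inr (mem_iUnion₂.mpr ⟨C, Finset.mem_filter.mpr ⟨hCZ', hfull⟩, hwC⟩)
    · exact Or.inl (mem_iUnion₂.mpr ⟨C, Finset.mem_filter.mpr ⟨hCZ', hfull⟩, hwC⟩)
  -- fibres
  have hfibO_open : ∀ v : Fin p → ℝ, IsOpen {z : Fin n → ℝ | (Fin.append v z :) ∈ O} := by
    intro v
    have heq : {z : Fin n → ℝ | (Fin.append v z :) ∈ O} = ⋃ C ∈ 𝒟full, {z : Fin n → ℝ | (Fin.append v z :) ∈ C} := by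
      ext z; simp [hOdef]
    rw [heq]
    refine isOpen_biUnion fun C hC => ?_
    rcases Set.eq_empty_or_nonempty {z : Fin n → ℝ | (Fin.append v z :) ∈ C} with h | hne
    · rw [h]; exact isOpen_empty
    · have hcell := IsCell.fibre (hι C (hmem𝒟 (Or.inr hC)).1) v hne
      have hfull : (fun j => ι C (Fin.natAdd p j)) = fun _ => true := (Finset.mem_filter.mp hC).2
      rw [hfull] at hcell
      exact hcell.isOpen
  have htrans : ∀ v : Fin p → ℝ, transPart {z : Fin n → ℝ | (Fin.append v z :) ∈ Z} ⊆
      transPart {z : Fin n → ℝ | (Fin.append v z :) ∈ X} := by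
    intro v
    have hZv : {z : Fin n → ℝ | (Fin.append v z :) ∈ Z} =
        {z : Fin n → ℝ | (Fin.append v z :) ∈ X} ∪ {z : Fin n → ℝ | (Fin.append v z :) ∈ O} := by
      ext z
      simp only [mem_setOf_eq, mem_union]
      constructor
      · intro h; exact hZXO h
      · rintro (h | h)
        · exact hXZ h
        · obtain ⟨C, hC, hzC⟩ := mem_iUnion₂.mp h
          exact (hmem𝒟 (Or.inr hC)).2 hzC
    rw [hZv]
    refine (transPart_union_subset _ _).trans ?_
    rw [transPart_eq_empty_of_isOpen hn (hfibO_open v), union_empty]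
  have hXsub : ∀ v : Fin p → ℝ, {z : Fin n → ℝ | (Fin.append v z :) ∈ X} ⊆ 𝕀^n :=
    fun v z hz => hZsub v (hXZ hz)
  have hXdim : ∀ v : Fin p → ℝ, CellDimension.dim L n {z : Fin n → ℝ | (Fin.append v z :) ∈ X} < n := by
    intro v
    have heq : {z : Fin n → ℝ | (Fin.append v z :) ∈ X} = ⋃ C ∈ 𝒟thin, {z : Fin n → ℝ | (Fin.append v z :) ∈ C} := by
      ext z; simp [hXdef]
    rw [heq, CellDimension.dim_biUnion_finset hO hlt _ _ fun C hC =>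
      definable_fibre_append ((hι C (hmem𝒟 (Or.inl hC)).1).definable hlt) v]
    refine (Finset.sup_lt_iff hn).mpr fun C hC => ?_
    rcases Set.eq_empty_or_nonempty {z : Fin n → ℝ | (Fin.append v z :) ∈ C} with h | hne
    · rw [h, CellDimension.dim_eq_zero_of_forall_not fun ι' C' hC' hsub => ?_]
      · exact hn
      · exact absurd (subset_empty_iff.mp hsub) hC'.nonempty.ne_empty
    · have hcell := IsCell.fibre (hι C (hmem𝒟 (Or.inl hC)).1) v hne
      rw [CellDimension.dim_eq_typeDim hO hlt hcell]
      have hne' : (fun j => ι C (Fin.natAdd p j)) ≠ fun _ => true := (Finset.mem_filter.mp hC).2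
      have hle := CellDimension.typeDim_le (fun j => ι C (Fin.natAdd p j))
      rcases hle.lt_or_eq with h | h
      · exact h
      · exact absurd (CellDimension.eq_const_true_of_typeDim_eq h) hne'
  ------------------------------------------------------------------ B: the Main Lemma for `X`
  obtain ⟨d, K, hd, hK, hML⟩ := mainLemma_family (p := p) (n := n) hO hadd hmul hUR X hXdefn hXsub (half_pos hε)
  ------------------------------------------------------------------ C: hypersurface cells and charts
  obtain ⟨D, tP, 𝒞, h𝒞, hcov⟩ := exists_hypersurface_cells (L := L) hadd hmul n d
  have hκex : ∀ C ∈ 𝒞, ∃ κ, IsCell L (D + n) κ C := fun C hC => (h𝒞 C hC).2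
  choose! κ hκ using hκex
  set τ' : Set (Fin (D + n) → ℝ) → (Fin n → Bool) := fun C j => κ C (Fin.natAdd D j) with hτ'
  have hchart := fun C : Set (Fin (D + n) → ℝ) => IsCell.exists_coordProj (L := L) n (τ' C)
  choose k hkle hklt σ hσ using hchart
  set 𝒞thin : Finset (Set (Fin (D + n) → ℝ)) := 𝒞.filter fun C => τ' C ≠ fun _ => true with h𝒞thin
  ------------------------------------------------------------------ D: the projected families
  set Y : ∀ C : Set (Fin (D + n) → ℝ), Set (Fin (p + D + k C) → ℝ) := fun C =>
    {u | ∃ x : Fin n → ℝ, (Fin.append (fun i : Fin p => u (Fin.castAdd (k C) (Fin.castAdd D i))) x :) ∈ X ∧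
      (Fin.append (fun i : Fin D => u (Fin.castAdd (k C) (Fin.natAdd p i))) x :) ∈ C ∧
      ∀ j, x (σ C j) = u (Fin.natAdd (p + D) j)} with hY
  have hYdef : ∀ C ∈ 𝒞, (univ : Set ℝ).Definable L (Y C) := by
    intro C hC
    have hCdef : (univ : Set ℝ).Definable L C := (h𝒞 C hC).1.definable_of_field hadd hmul
    -- the relation in the variables `(u, x)`
    set θ₁ : Fin (p + n) → (Fin (p + D + k C) ⊕ Fin n) :=
      Fin.addCases (fun i => Sum.inl (Fin.castAdd (k C) (Fin.castAdd D i))) (fun j => Sum.inr j) with hθ₁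
    set θ₂ : Fin (D + n) → (Fin (p + D + k C) ⊕ Fin n) :=
      Fin.addCases (fun i => Sum.inl (Fin.castAdd (k C) (Fin.natAdd p i))) (fun j => Sum.inr j) with hθ₂
    have happ₁ : ∀ g : Fin (p + D + k C) ⊕ Fin n → ℝ, (g ∘ θ₁) =
        Fin.append (fun i : Fin p => g (Sum.inl (Fin.castAdd (k C) (Fin.castAdd D i)))) (fun j => g (Sum.inr j)) := by
      intro g; funext l
      refine Fin.addCases (fun i => ?_) (fun j => ?_) l
      · simp [hθ₁]
      · simp [hθ₁]
    have happ₂ : ∀ g : Fin (p + D + k C) ⊕ Fin n → ℝ, (g ∘ θ₂) =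
        Fin.append (fun i : Fin D => g (Sum.inl (Fin.castAdd (k C) (Fin.natAdd p i)))) (fun j => g (Sum.inr j)) := by
      intro g; funext l
      refine Fin.addCases (fun i => ?_) (fun j => ?_) l
      · simp [hθ₂]
      · simp [hθ₂]
    have hS' : (univ : Set ℝ).Definable L {g : Fin (p + D + k C) ⊕ Fin n → ℝ |
        (Fin.append (fun i : Fin p => g (Sum.inl (Fin.castAdd (k C) (Fin.castAdd D i)))) (fun j => g (Sum.inr j)) :) ∈ X ∧
        (Fin.append (fun i : Fin D => g (Sum.inl (Fin.castAdd (k C) (Fin.natAdd p i)))) (fun j => g (Sum.inr j)) :) ∈ C ∧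
        ∀ j, g (Sum.inr (σ C j)) = g (Sum.inl (Fin.natAdd (p + D) j))} := by
      refine Definable.inter ?_ (Definable.inter ?_ ?_)
      · have h := hXdefn.preimage_comp θ₁
        convert h using 1
        ext g
        show _ ↔ (g ∘ θ₁) ∈ X
        rw [happ₁]; rfl
      · have h := hCdef.preimage_comp θ₂
        convert h using 1
        ext g
        show _ ↔ (g ∘ θ₂) ∈ C
        rw [happ₂]; rfl
      · have h := definable_iInter_of_finite (L := L) (A := (univ : Set ℝ))
          (f := fun j : Fin (k C) => {g : Fin (p + D + k C) ⊕ Fin n → ℝ | g (Sum.inr (σ C j)) = g (Sum.inl (Fin.natAdd (p + D) j))})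
          (fun j => definable_setOf_eq' (definableFun_proj _) (definableFun_proj _))
        convert h using 1
        ext g
        simp only [mem_iInter, mem_setOf_eq]
        exact Iff.rfl
    have h := hS'.image_comp (Sum.inl : Fin (p + D + k C) → Fin (p + D + k C) ⊕ Fin n)
    convert h using 1
    ext u
    simp only [hY, mem_setOf_eq, mem_image]
    constructor
    · rintro ⟨x, hx1, hx2, hx3⟩
      refine ⟨Sum.elim u x, ⟨?_, ?_, fun j => ?_⟩, ?_⟩
      · simpa using hx1
      · simpa using hx2
      · simpa using hx3 j
      · funext i; rfl
    · rintro ⟨g, ⟨hg1, hg2, hg3⟩, rfl⟩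
      exact ⟨fun j => g (Sum.inr j), hg1, hg2, fun j => hg3 j⟩
  have hYsub : ∀ C ∈ 𝒞, ∀ w : Fin (p + D) → ℝ, {y : Fin (k C) → ℝ | (Fin.append w y :) ∈ Y C} ⊆ 𝕀^(k C) := by
    intro C _ w y hy
    obtain ⟨x, hx1, -, hx3⟩ := hy
    intro j _
    have hxcube := hXsub _ hx1 (σ C j) (mem_univ _)
    have h3 := hx3 j
    simp only [Fin.append_right] at h3
    rw [← h3]; exact hxcube
  -- the fibre of `Y C` over `(v, t)` is the chart image of `X_v ∩ C(t)`
  have hYfib : ∀ C (v : Fin p → ℝ) (t : Fin D → ℝ),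
      {y : Fin (k C) → ℝ | (Fin.append (Fin.append v t) y :) ∈ Y C} =
        (fun x : Fin n → ℝ => x ∘ σ C) '' ({z : Fin n → ℝ | (Fin.append v z :) ∈ X} ∩ {z : Fin n → ℝ | (Fin.append t z :) ∈ C}) := by
    intro C v t
    ext y
    simp only [hY, mem_setOf_eq, mem_image, mem_inter_iff, Fin.append_left, Fin.append_right]
    constructor
    · rintro ⟨x, hx1, hx2, hx3⟩
      exact ⟨x, ⟨by simpa using hx1, by simpa using hx2⟩, funext fun j => hx3 j⟩
    · rintro ⟨x, ⟨hx1, hx2⟩, rfl⟩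
      exact ⟨x, by simpa using hx1, by simpa using hx2, fun j => rfl⟩
  -- the induction hypothesis for each thin cell
  have hIH : ∀ C ∈ 𝒞thin, ∃ c : ℝ, 0 ≤ c ∧ ∀ (w : Fin (p + D) → ℝ) (H : ℕ), 1 ≤ H →
      (ratPointsLE (transPart {y : Fin (k C) → ℝ | (Fin.append w y :) ∈ Y C}) H).Finite ∧
      ((ratPointsLE (transPart {y : Fin (k C) → ℝ | (Fin.append w y :) ∈ Y C}) H).ncard : ℝ) ≤ c * (H : ℝ) ^ (ε / 2) := by
    intro C hC
    obtain ⟨hC𝒞, hthin⟩ := Finset.mem_filter.mp hC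
    have hkn : k C < n := hklt C hthin
    exact ih (k C) hkn (fun r ℓ hℓ => hUR r ℓ (hℓ.trans hkn)) (p + D) (Y C) (hYdef C hC𝒞) (hYsub C hC𝒞)
      (ε / 2) (half_pos hε)
  choose! cst hcst0 hcst using hIH
  ------------------------------------------------------------------ E: the constant
  set c : ℝ := K * ∑ C ∈ 𝒞thin, cst C with hc
  have hsum0 : 0 ≤ ∑ C ∈ 𝒞thin, cst C := Finset.sum_nonneg fun C hC => hcst0 C hC
  refine ⟨c, mul_nonneg hK.le hsum0, fun v H hH => ?_⟩
  ------------------------------------------------------------------ F: counting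
  set Xv : Set (Fin n → ℝ) := {z : Fin n → ℝ | (Fin.append v z :) ∈ X} with hXv
  obtain ⟨Ps, hPcard, hPdeg, hPsub⟩ := hML v (hXdim v) H hH
  set Cfib : Set (Fin (D + n) → ℝ) → MvPolynomial (Fin n) ℝ → Set (Fin n → ℝ) := fun C P =>
    {x : Fin n → ℝ | (Fin.append (tP P) x :) ∈ C} with hCfib
  set piece : MvPolynomial (Fin n) ℝ → Set (Fin (D + n) → ℝ) → Set (Fin n → ℝ) := fun P C =>
    ratPointsLE (transPart (Xv ∩ Cfib C P)) H with hpiece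
  -- each piece is finite and small
  have hpieceB : ∀ P ∈ Ps, ∀ C ∈ 𝒞thin, (piece P C).Finite ∧ ((piece P C).ncard : ℝ) ≤ cst C * (H : ℝ) ^ (ε / 2) := by
    intro P hP C hC
    obtain ⟨hC𝒞, hthin⟩ := Finset.mem_filter.mp hC
    have hS : IsSemialgebraic ℝ (Cfib C P) := (h𝒞 C hC𝒞).1.fibre_append (tP P)
    rcases Set.eq_empty_or_nonempty (Xv ∩ Cfib C P) with hempty | hne
    · simp only [hpiece, hempty]
      have : ratPointsLE (transPart (∅ : Set (Fin n → ℝ))) H = ∅ :=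
        Set.eq_empty_of_subset_empty ((ratPointsLE_subset _ _).trans (transPart_subset _))
      rw [this]
      simp only [Set.finite_empty, Set.ncard_empty, Nat.cast_zero, true_and]
      exact mul_nonneg (hcst0 C hC) (by positivity)
    · have hne' : (Cfib C P).Nonempty := hne.mono inter_subset_right
      have hcell : IsCell L n (τ' C) (Cfib C P) := IsCell.fibre (hκ C hC𝒞) (tP P) hne'
      obtain ⟨q, hq, hqc, -⟩ := hσ C (Cfib C P) hcell
      have hIHC := hcst C hC (Fin.append v (tP P)) H hH
      rw [hYfib C v (tP P)] at hIHC
      obtain ⟨hfin, hle⟩ := ncard_ratPointsLE_transPart_le_coordProj (σ C) hS inter_subset_right hq hqc H hIHC.1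
      refine ⟨hfin, le_trans ?_ hIHC.2⟩
      exact_mod_cast hle
  -- the rational points of `X_v^{tr}` lie in the pieces
  have hcover : ratPointsLE (transPart Xv) H ⊆ ⋃ P ∈ Ps, ⋃ C ∈ 𝒞thin, piece P C := by
    intro x hx
    have hxX : x ∈ ratPointsLE Xv H := ⟨hx.1.1, hx.2⟩
    have hxV := hPsub hxX
    simp only [mem_iUnion] at hxV
    obtain ⟨P, hP, hPx⟩ := hxV
    have hPx' : MvPolynomial.eval x P = 0 := hPx
    obtain ⟨C, hC𝒞, hxC⟩ := (hcov P (hPdeg P hP).2 x).mp hPx'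
    -- `C` is thin: an open fibre cell inside the hypersurface would have interior
    have hthin : τ' C ≠ fun _ => true := by
      intro hfull
      have hcell : IsCell L n (τ' C) (Cfib C P) :=
        IsCell.fibre (hκ C hC𝒞) (tP P) (⟨x, hxC⟩ : ∃ y, (Fin.append (tP P) y :) ∈ C)
      rw [hfull] at hcell
      have hopen : IsOpen (Cfib C P) := hcell.isOpen
      have hsub : Cfib C P ⊆ {y : Fin n → ℝ | MvPolynomial.eval y P = 0} :=
        fun y hy => (hcov P (hPdeg P hP).2 y).mpr ⟨C, hC𝒞, hy⟩
      have hint := interior_maximal hsub hopen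
      rw [interior_zeroSet_eq_empty (hPdeg P hP).1] at hint
      exact hint hxC
    simp only [mem_iUnion]
    exact ⟨P, hP, C, Finset.mem_filter.mpr ⟨hC𝒞, hthin⟩, mem_transPart_inter hx.1 hxC, hx.2⟩
  -- add up
  have hinner : ∀ P ∈ Ps, (⋃ C ∈ 𝒞thin, piece P C).Finite ∧
      ((⋃ C ∈ 𝒞thin, piece P C).ncard : ℝ) ≤ (∑ C ∈ 𝒞thin, cst C) * (H : ℝ) ^ (ε / 2) := by
    intro P hP
    obtain ⟨hfin, hle⟩ := ncard_biUnion_le_sum 𝒞thin (piece P) fun C hC => (hpieceB P hP C hC).1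
    refine ⟨hfin, ?_⟩
    calc ((⋃ C ∈ 𝒞thin, piece P C).ncard : ℝ) ≤ ∑ C ∈ 𝒞thin, ((piece P C).ncard : ℝ) := by
          exact_mod_cast hle
      _ ≤ ∑ C ∈ 𝒞thin, cst C * (H : ℝ) ^ (ε / 2) := Finset.sum_le_sum fun C hC => (hpieceB P hP C hC).2
      _ = (∑ C ∈ 𝒞thin, cst C) * (H : ℝ) ^ (ε / 2) := by rw [Finset.sum_mul]
  obtain ⟨hfinU, hleU⟩ := ncard_biUnion_le_sum Ps (fun P => ⋃ C ∈ 𝒞thin, piece P C) fun P hP => (hinner P hP).1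
  have hfinX : (ratPointsLE (transPart Xv) H).Finite := hfinU.subset hcover
  have hfinZ : (ratPointsLE (transPart {z : Fin n → ℝ | (Fin.append v z :) ∈ Z}) H).Finite :=
    hfinX.subset fun x hx => ⟨htrans v hx.1, hx.2⟩
  refine ⟨hfinZ, ?_⟩
  have hH0 : (0 : ℝ) < H := by exact_mod_cast hH
  have hsubZX : ratPointsLE (transPart {z : Fin n → ℝ | (Fin.append v z :) ∈ Z}) H ⊆ ratPointsLE (transPart Xv) H :=
    fun x hx => ⟨htrans v hx.1, hx.2⟩
  calc ((ratPointsLE (transPart {z : Fin n → ℝ | (Fin.append v z :) ∈ Z}) H).ncard : ℝ)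
      ≤ ((ratPointsLE (transPart Xv) H).ncard : ℝ) := by
        exact_mod_cast Set.ncard_le_ncard hsubZX hfinX
    _ ≤ ((⋃ P ∈ Ps, ⋃ C ∈ 𝒞thin, piece P C).ncard : ℝ) := by
        exact_mod_cast Set.ncard_le_ncard hcover hfinU
    _ ≤ ∑ P ∈ Ps, ((⋃ C ∈ 𝒞thin, piece P C).ncard : ℝ) := by exact_mod_cast hleU
    _ ≤ ∑ P ∈ Ps, (∑ C ∈ 𝒞thin, cst C) * (H : ℝ) ^ (ε / 2) := Finset.sum_le_sum fun P hP => (hinner P hP).2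
    _ = (Ps.card : ℝ) * ((∑ C ∈ 𝒞thin, cst C) * (H : ℝ) ^ (ε / 2)) := by rw [Finset.sum_const, nsmul_eq_mul]
    _ ≤ K * (H : ℝ) ^ (ε / 2) * ((∑ C ∈ 𝒞thin, cst C) * (H : ℝ) ^ (ε / 2)) :=
        mul_le_mul_of_nonneg_right hPcard (mul_nonneg hsum0 (by positivity))
    _ = c * (H : ℝ) ^ ε := by
        rw [hc]
        have : (H : ℝ) ^ (ε / 2) * (H : ℝ) ^ (ε / 2) = (H : ℝ) ^ ε := by
          rw [← Real.rpow_add hH0]; ring_nf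
        calc K * (H : ℝ) ^ (ε / 2) * ((∑ C ∈ 𝒞thin, cst C) * (H : ℝ) ^ (ε / 2))
            = K * (∑ C ∈ 𝒞thin, cst C) * ((H : ℝ) ^ (ε / 2) * (H : ℝ) ^ (ε / 2)) := by ring
          _ = K * (∑ C ∈ 𝒞thin, cst C) * (H : ℝ) ^ ε := by rw [this]

end CountingFamilies

/-! ### The counting theorem from the uniform `r`-reparametrization property -/

section Final

variable {L : Language} [L.Structure ℝ]

/-- Local notation: the open unit cube `(0,1)^ℓ`. -/
local notation "𝕀^" ℓ:max => (Set.pi Set.univ fun _ : Fin ℓ => Set.Ioo (0 : ℝ) 1)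

/-- **Pila–Wilkie 2006, Thm. 1.8, conditional on the uniform `r`-reparametrization property
of definable families** (the o-minimal Yomdin–Gromov theorem, Pila–Wilkie 2006 §§4–5 /
Bhardwaj–van den Dries 2022 §§6–7, here as the inline hypothesis `UR(r, ℓ)` for every
o-minimal expansion of the real field, every `r` and every `ℓ`): then for every definable
`X ⊆ ℝ^n` and `ε > 0` there is `c` with `N(X^{tr}, H) ≤ c H^ε` for all `H ≥ 1`.  (Cube
reduction `PilaWilkie2006_thm_1_8_of_unitCube` + the family counting theorem
`countingFamily` for the one-member family.) [cite: PilaWilkie2006, Thm. 1.8]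
[cite: BhardwajVanDenDries2022, Thm. 2.4] -/
theorem PilaWilkie2006_thm_1_8_of_uniformReparam
    (hUR : ∀ (L : FirstOrder.Language.{0, 0}) [L.Structure ℝ], L.IsOMinimal ℝ →
      (univ : Set ℝ).Definable L {v : Fin 3 → ℝ | v 0 + v 1 = v 2} →
      (univ : Set ℝ).Definable L {v : Fin 3 → ℝ | v 0 * v 1 = v 2} →
      ∀ (r ℓ : ℕ) (n' m : ℕ) (F : Fin n' → (Fin m → ℝ) → (Fin ℓ → ℝ) → ℝ),
      (∀ l, IsDefinableFamily L (F l)) → (∀ l v, ∀ x ∈ 𝕀^ℓ, |F l v x| ≤ 1) →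
      ∃ (κ : Type) (_ : Fintype κ) (ψ : κ → (Fin m → ℝ) → (Fin ℓ → ℝ) → (Fin ℓ → ℝ)),
        (∀ j c, IsDefinableFamily L (fun v x => ψ j v x c)) ∧
        ∀ v, (∀ j, MapsTo (ψ j v) (𝕀^ℓ) (𝕀^ℓ)) ∧ (⋃ j, ψ j v '' 𝕀^ℓ) = 𝕀^ℓ ∧
          (∀ j c, ContDiffOn ℝ r (fun x => ψ j v x c) (𝕀^ℓ)) ∧
          (∀ j c, ∀ q ≤ r, ∀ x ∈ 𝕀^ℓ, ‖iteratedFDeriv ℝ q (fun x => ψ j v x c) x‖ ≤ 1) ∧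
          (∀ j l, ContDiffOn ℝ r (fun x => F l v (ψ j v x)) (𝕀^ℓ)) ∧
          (∀ j l, ∀ q ≤ r, ∀ x ∈ 𝕀^ℓ, ‖iteratedFDeriv ℝ q (fun x => F l v (ψ j v x)) x‖ ≤ 1)) :
    PilaWilkie2006_thm_1_8 := by
  refine PilaWilkie2006_thm_1_8_of_unitCube fun L _ hO hadd hmul n Y hYcube hY ε hε => ?_
  -- the one-member family over `ℝ^0`
  set Z : Set (Fin (0 + n) → ℝ) := {w | (fun j : Fin n => w (Fin.natAdd 0 j)) ∈ Y} with hZ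
  have hZdef : (univ : Set ℝ).Definable L Z := hY.preimage_comp (fun j : Fin n => Fin.natAdd 0 j)
  have hfib : ∀ v : Fin 0 → ℝ, {z : Fin n → ℝ | (Fin.append v z :) ∈ Z} = Y := by
    intro v; ext z
    simp only [hZ, mem_setOf_eq, Fin.append_right]
  obtain ⟨c, -, hc⟩ := countingFamily hO hadd hmul n (fun r ℓ _ => hUR L hO hadd hmul r ℓ) 0 Z hZdef
    (fun v => by rw [hfib v]; exact hYcube) ε hε
  refine ⟨c, fun H hH => ?_⟩
  have h := hc Fin.elim0 H hH
  rw [hfib] at h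
  exact h

end Final


end Literature.ModelTheory.ExponentialFields

end
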